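import Summits.ResolutionOfSingularities.ResolutionOfSingularities.Theorems.HilbertSamuelEliminationSigmaMaxModificationsCorridor3WLadderTowerCompress
import HarnessLib

/-!
# [OURS · L1 W4.2] CUTTING A CHAIN INTO SEGMENTS — the index combinatorics of the units-half extraction
# (crux `SigmaMaxModifications` stmt-ResolutionOfSingularities-18506; conjunct `SigmaMaxModificationsCorridor3` stmt-…-19249; line
# `w_ladder` v6; plan-1 RULINGS v3.10-1 (A) «U-seg = segment extraction», object `Moving.UnitTowerExtractionLocAtQM`)

Stub worker res-L1-w42-stub-1 (gen 3). Helper file `--supports stmt-ResolutionOfSingularities-19249 --as helper`; kernel only, no named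
fact. PURE `ℕ`-COMBINATORICS (no schemes): the bookkeeping that cuts an infinite chain of marked stages into consecutive segments
(CJS Def. 6.39: «the terminal part of `𝒳_i` coincides with initial part of `𝒳_{i+1}`»), parametrised by two predicates on indices —
`B n` («stage `n` is BLOWN UP at its marked point», a genuine step) and `G n` («stage `n` is a CUT stage», in the application: the marked
point is isolated in its Hilbert–Samuel locus) — each holding infinitely often.

* `nextB hB n` — the least `B`-stage `≥ n`; `bSeq hB n₀` — the increasing enumeration `n₀ = g_0 < g_1 < ⋯` of the `B`-stages from a
  `B`-stage `n₀`; `bGap hB n₀ k = g_{k+1} − g_k − 1` — the number of skipped (non-`B`) stages, so that the compression index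
  `BlowupTower.cidx n₀ (bGap hB n₀) k` of `…Corridor3WLadderTowerCompress` IS `g_k` (`cidx_bGap`), and the stages strictly between
  consecutive `g_k` are not `B`-stages (`not_B_cidx_bGap_add` — the shape of the hypothesis `htriv` of `BlowupTower.compress`);
  every `B`-stage `≥ n₀` is some `g_k` (`exists_bSeq_eq`).
* `segLen hB hBG n₀` — the length of the segment based at the `B`-stage `n₀`: the least `L ≥ 1` such that `g_L` is a cut stage
  (exists as `B ∧ G` holds infinitely often); no `g_L` with `1 ≤ L < segLen` is a cut stage (`not_G_cidx_of_lt_segLen`).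
* `segBase hB hBG i` — the bases `m_0 < m_1 < ⋯` of the consecutive segments: `m_0` the least stage with `B ∧ G`, and
  `m_{i+1} = m_i + cidx 0 (bGap (hB.shift m_i) 0) (segLen …)` — BY DEFINITION the `segLen`-th `B`-stage after `m_i`, read in the chain
  SHIFTED to `m_i` (`Shift.B m k = B (m + k)`), which is how the unit towers are indexed (no casts downstream); every base is a `B`-stage
  and a cut stage (`B_segBase`, `G_segBase`).

OURS bookkeeping; NOT a statement of the manuscript [Hironaka2017] nor of [CossartJannsenSaito2020]. AI-written; AI review is weaker than
expert review.

References: V. Cossart, U. Jannsen, S. Saito, LNM 2270 (2020), Def. 6.38, Def. 6.39 [CossartJannsenSaito2020].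
-/

noncomputable section

set_option linter.dupNamespace false -- namespace `…Corridor3.Moving` re-enters `…Corridor3` (module convention of the Moving files)

open Literature.AlgebraicGeometry.CossartJannsenSaito2020

namespace Summit.ResolutionOfSingularities.ResolutionOfSingularities.Theorems.SigmaMaxModificationsCorridor3.Moving.Seg

variable {B G : ℕ → Prop}

/-! ## §1. The next `B`-stage and the enumeration of the `B`-stages -/

open Classical in
/-- [OURS] The least `B`-stage `≥ n` (exists: `B` holds infinitely often). [folklore] -/
def nextB (hB : ∀ n, ∃ m, n ≤ m ∧ B m) (n : ℕ) : ℕ :=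
  Nat.find (hB n)

open Classical in
/-- `n ≤ nextB n` and `B (nextB n)`. [folklore] -/
theorem nextB_spec (hB : ∀ n, ∃ m, n ≤ m ∧ B m) (n : ℕ) : n ≤ nextB hB n ∧ B (nextB hB n) :=
  Nat.find_spec (hB n)

/-- `n ≤ nextB n`. [folklore] -/
theorem le_nextB (hB : ∀ n, ∃ m, n ≤ m ∧ B m) (n : ℕ) : n ≤ nextB hB n :=
  (nextB_spec hB n).1

/-- `B (nextB n)`. [folklore] -/
theorem B_nextB (hB : ∀ n, ∃ m, n ≤ m ∧ B m) (n : ℕ) : B (nextB hB n) :=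
  (nextB_spec hB n).2

open Classical in
/-- Minimality: a `B`-stage `m ≥ n` bounds `nextB n`. [folklore] -/
theorem nextB_le (hB : ∀ n, ∃ m, n ≤ m ∧ B m) {n m : ℕ} (hnm : n ≤ m) (hm : B m) : nextB hB n ≤ m :=
  Nat.find_min' (hB n) ⟨hnm, hm⟩

open Classical in
/-- Minimality: no `B`-stage in `[n, nextB n)`. [folklore] -/
theorem not_B_of_lt_nextB (hB : ∀ n, ∃ m, n ≤ m ∧ B m) {n j : ℕ} (hnj : n ≤ j) (hj : j < nextB hB n) : ¬ B j :=
  fun hBj => absurd (nextB_le hB hnj hBj) (not_le.mpr hj)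

/-- A `B`-stage is its own `nextB`. [folklore] -/
theorem nextB_eq_self (hB : ∀ n, ∃ m, n ≤ m ∧ B m) {n : ℕ} (hn : B n) : nextB hB n = n :=
  le_antisymm (nextB_le hB le_rfl hn) (le_nextB hB n)

/-- [OURS] The increasing enumeration `g_0 = n₀, g_{k+1} = nextB (g_k + 1)` of the `B`-stages from `n₀`. [folklore] -/
def bSeq (hB : ∀ n, ∃ m, n ≤ m ∧ B m) (n₀ : ℕ) : ℕ → ℕ
  | 0 => n₀
  | k + 1 => nextB hB (bSeq hB n₀ k + 1)

/-- Unfolding. [folklore] -/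
@[simp] theorem bSeq_zero (hB : ∀ n, ∃ m, n ≤ m ∧ B m) (n₀ : ℕ) : bSeq hB n₀ 0 = n₀ := rfl

/-- Unfolding. [folklore] -/
theorem bSeq_succ (hB : ∀ n, ∃ m, n ≤ m ∧ B m) (n₀ k : ℕ) : bSeq hB n₀ (k + 1) = nextB hB (bSeq hB n₀ k + 1) := rfl

/-- `g_k < g_{k+1}`. [folklore] -/
theorem bSeq_lt_succ (hB : ∀ n, ∃ m, n ≤ m ∧ B m) (n₀ k : ℕ) : bSeq hB n₀ k < bSeq hB n₀ (k + 1) :=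
  Nat.lt_of_lt_of_le (Nat.lt_succ_self _) (le_nextB hB _)

/-- The enumeration is strictly increasing. [folklore] -/
theorem bSeq_strictMono (hB : ∀ n, ∃ m, n ≤ m ∧ B m) (n₀ : ℕ) : StrictMono (bSeq hB n₀) :=
  strictMono_nat_of_lt_succ fun k => bSeq_lt_succ hB n₀ k

/-- `n₀ + k ≤ g_k`. [folklore] -/
theorem add_le_bSeq (hB : ∀ n, ∃ m, n ≤ m ∧ B m) (n₀ k : ℕ) : n₀ + k ≤ bSeq hB n₀ k := by
  induction k with
  | zero => simp
  | succ k ih => have := bSeq_lt_succ hB n₀ k; omega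

/-- Every `g_{k+1}` is a `B`-stage; so is `g_0 = n₀` when `n₀` is. [folklore] -/
theorem B_bSeq (hB : ∀ n, ∃ m, n ≤ m ∧ B m) {n₀ : ℕ} (h0 : B n₀) : ∀ k, B (bSeq hB n₀ k)
  | 0 => h0
  | k + 1 => B_nextB hB (bSeq hB n₀ k + 1)

/-- No `B`-stage strictly between `g_k` and `g_{k+1}`. [folklore] -/
theorem not_B_of_bSeq_lt_of_lt_bSeq_succ (hB : ∀ n, ∃ m, n ≤ m ∧ B m) (n₀ : ℕ) {k j : ℕ} (h₁ : bSeq hB n₀ k < j)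
    (h₂ : j < bSeq hB n₀ (k + 1)) : ¬ B j :=
  not_B_of_lt_nextB hB (Nat.succ_le_of_lt h₁) h₂

/-- Every `B`-stage `m ≥ n₀` is some `g_k`. [folklore] -/
theorem exists_bSeq_eq (hB : ∀ n, ∃ m, n ≤ m ∧ B m) {n₀ m : ℕ} (hm : n₀ ≤ m) (hBm : B m) : ∃ k, bSeq hB n₀ k = m := by
  classical
  -- the least `k` with `m ≤ g_k` (exists: `g_{m} ≥ n₀ + m ≥ m`)
  have hex : ∃ k, m ≤ bSeq hB n₀ k := ⟨m, (Nat.le_add_left m n₀).trans (add_le_bSeq hB n₀ m)⟩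
  refine ⟨Nat.find hex, le_antisymm ?_ (Nat.find_spec hex)⟩
  rcases Nat.eq_zero_or_eq_succ_pred (Nat.find hex) with h0 | hsucc
  · rw [h0, bSeq_zero]; exact hm
  · have hlt : bSeq hB n₀ (Nat.find hex - 1) < m := by
      have := Nat.find_min hex (show Nat.find hex - 1 < Nat.find hex by omega)
      exact not_le.mp this
    rw [hsucc, bSeq_succ]
    exact nextB_le hB (Nat.succ_le_of_lt hlt) hBm

/-! ## §2. The gaps, matched with the compression indices `BlowupTower.cidx` -/

/-- [OURS] The number of non-`B` stages skipped between `g_k` and `g_{k+1}`: `g_{k+1} − g_k − 1`. [folklore] -/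
def bGap (hB : ∀ n, ∃ m, n ≤ m ∧ B m) (n₀ : ℕ) (k : ℕ) : ℕ :=
  bSeq hB n₀ (k + 1) - (bSeq hB n₀ k + 1)

/-- `g_k + bGap k + 1 = g_{k+1}`. [folklore] -/
theorem bSeq_add_bGap (hB : ∀ n, ∃ m, n ≤ m ∧ B m) (n₀ k : ℕ) : bSeq hB n₀ k + bGap hB n₀ k + 1 = bSeq hB n₀ (k + 1) := by
  have := bSeq_lt_succ hB n₀ k
  unfold bGap
  omega

/-- **The compression indices of `…WLadderTowerCompress` for the gap function `bGap` ARE the `B`-stages**: `cidx n₀ (bGap n₀) k = g_k`.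
[folklore] -/
theorem cidx_bGap (hB : ∀ n, ∃ m, n ≤ m ∧ B m) (n₀ : ℕ) : ∀ k, BlowupTower.cidx n₀ (bGap hB n₀) k = bSeq hB n₀ k
  | 0 => rfl
  | k + 1 => by rw [BlowupTower.cidx_succ, cidx_bGap hB n₀ k, bSeq_add_bGap]

/-- Every compression index is a `B`-stage (from a `B`-stage `n₀`). [folklore] -/
theorem B_cidx_bGap (hB : ∀ n, ∃ m, n ≤ m ∧ B m) {n₀ : ℕ} (h0 : B n₀) (k : ℕ) : B (BlowupTower.cidx n₀ (bGap hB n₀) k) := by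
  rw [cidx_bGap]; exact B_bSeq hB h0 k

/-- **The skipped stages are not `B`-stages** — the shape of the hypothesis `htriv` of `BlowupTower.compress`: for `j < bGap k`, the stage
`cidx n₀ (bGap n₀) k + j + 1` is not blown up. [folklore] -/
theorem not_B_cidx_bGap_add (hB : ∀ n, ∃ m, n ≤ m ∧ B m) (n₀ : ℕ) {k j : ℕ} (hj : j < bGap hB n₀ k) :
    ¬ B (BlowupTower.cidx n₀ (bGap hB n₀) k + j + 1) := by
  rw [cidx_bGap]
  have := bSeq_add_bGap hB n₀ k
  exact not_B_of_bSeq_lt_of_lt_bSeq_succ hB n₀ (k := k) (by omega) (by omega)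

/-- Every `B`-stage `m ≥ n₀` is some compression index. [folklore] -/
theorem exists_cidx_bGap_eq (hB : ∀ n, ∃ m, n ≤ m ∧ B m) {n₀ m : ℕ} (hm : n₀ ≤ m) (hBm : B m) :
    ∃ k, BlowupTower.cidx n₀ (bGap hB n₀) k = m := by
  obtain ⟨k, hk⟩ := exists_bSeq_eq hB hm hBm
  exact ⟨k, (cidx_bGap hB n₀ k).trans hk⟩

/-- The compression indices from `n₀` are `≥ n₀`, with equality only at `k = 0`. [folklore] -/
theorem lt_cidx_bGap_of_pos (hB : ∀ n, ∃ m, n ≤ m ∧ B m) (n₀ : ℕ) {k : ℕ} (hk : 1 ≤ k) : n₀ < BlowupTower.cidx n₀ (bGap hB n₀) k := by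
  rw [cidx_bGap]
  calc n₀ = bSeq hB n₀ 0 := rfl
    _ < bSeq hB n₀ k := bSeq_strictMono hB n₀ (by omega)

/-! ## §3. Segment lengths: the first later `B`-stage that is a cut stage -/

/-- From a `B`-stage `n₀`, if `B ∧ G` holds infinitely often then some LATER enumerated `B`-stage `g_L`, `L ≥ 1`, is a cut stage.
[folklore] -/
theorem exists_one_le_and_G_cidx (hB : ∀ n, ∃ m, n ≤ m ∧ B m) (hBG : ∀ n, ∃ m, n ≤ m ∧ B m ∧ G m) (n₀ : ℕ) :
    ∃ L, 1 ≤ L ∧ G (BlowupTower.cidx n₀ (bGap hB n₀) L) := by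
  obtain ⟨m, hm, hBm, hGm⟩ := hBG (n₀ + 1)
  obtain ⟨k, hk⟩ := exists_cidx_bGap_eq hB (n₀ := n₀) (m := m) (by omega) hBm
  refine ⟨k, ?_, hk ▸ hGm⟩
  by_contra h0
  obtain rfl : k = 0 := by omega
  rw [BlowupTower.cidx_zero] at hk
  omega

open Classical in
/-- [OURS] THE LENGTH OF THE SEGMENT BASED AT `n₀`: the least `L ≥ 1` whose `B`-stage `g_L = cidx n₀ (bGap n₀) L` is a cut stage
(CJS Def. 6.38: the unit runs to its terminal part). [cite: CossartJannsenSaito2020, Def. 6.38] -/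
def segLen (hB : ∀ n, ∃ m, n ≤ m ∧ B m) (hBG : ∀ n, ∃ m, n ≤ m ∧ B m ∧ G m) (n₀ : ℕ) : ℕ :=
  Nat.find (exists_one_le_and_G_cidx hB hBG n₀)

open Classical in
/-- `1 ≤ segLen` and the `segLen`-th `B`-stage is a cut stage. [folklore] -/
theorem segLen_spec (hB : ∀ n, ∃ m, n ≤ m ∧ B m) (hBG : ∀ n, ∃ m, n ≤ m ∧ B m ∧ G m) (n₀ : ℕ) :
    1 ≤ segLen hB hBG n₀ ∧ G (BlowupTower.cidx n₀ (bGap hB n₀) (segLen hB hBG n₀)) :=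
  Nat.find_spec (exists_one_le_and_G_cidx hB hBG n₀)

/-- `1 ≤ segLen`. [folklore] -/
theorem one_le_segLen (hB : ∀ n, ∃ m, n ≤ m ∧ B m) (hBG : ∀ n, ∃ m, n ≤ m ∧ B m ∧ G m) (n₀ : ℕ) : 1 ≤ segLen hB hBG n₀ :=
  (segLen_spec hB hBG n₀).1

/-- The `segLen`-th `B`-stage is a cut stage. [folklore] -/
theorem G_cidx_segLen (hB : ∀ n, ∃ m, n ≤ m ∧ B m) (hBG : ∀ n, ∃ m, n ≤ m ∧ B m ∧ G m) (n₀ : ℕ) :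
    G (BlowupTower.cidx n₀ (bGap hB n₀) (segLen hB hBG n₀)) :=
  (segLen_spec hB hBG n₀).2

open Classical in
/-- Minimality: no `B`-stage `g_L` with `1 ≤ L < segLen` is a cut stage. [folklore] -/
theorem not_G_cidx_of_lt_segLen (hB : ∀ n, ∃ m, n ≤ m ∧ B m) (hBG : ∀ n, ∃ m, n ≤ m ∧ B m ∧ G m) (n₀ : ℕ) {L : ℕ} (h1 : 1 ≤ L)
    (hL : L < segLen hB hBG n₀) : ¬ G (BlowupTower.cidx n₀ (bGap hB n₀) L) :=
  fun hG => Nat.find_min (exists_one_le_and_G_cidx hB hBG n₀) hL ⟨h1, hG⟩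

/-! ## §4. Shifting the chain to a base, and the bases of the consecutive segments -/

/-- `B` holds infinitely often in the chain SHIFTED to `m` (`k ↦ B (m + k)`). [folklore] -/
theorem shift_io (hB : ∀ n, ∃ m, n ≤ m ∧ B m) (m : ℕ) : ∀ n, ∃ k, n ≤ k ∧ B (m + k) := fun n => by
  obtain ⟨m', hm', hB'⟩ := hB (m + n)
  exact ⟨m' - m, by omega, by rwa [Nat.add_sub_cancel' (by omega : m ≤ m')]⟩

/-- `B ∧ G` holds infinitely often in the chain shifted to `m`. [folklore] -/
theorem shift_io₂ (hBG : ∀ n, ∃ m, n ≤ m ∧ B m ∧ G m) (m : ℕ) : ∀ n, ∃ k, n ≤ k ∧ B (m + k) ∧ G (m + k) := fun n => by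
  obtain ⟨m', hm', hB', hG'⟩ := hBG (m + n)
  exact ⟨m' - m, by omega, by rwa [Nat.add_sub_cancel' (by omega : m ≤ m')], by rwa [Nat.add_sub_cancel' (by omega : m ≤ m')]⟩

/-- [OURS] The gap function of the chain shifted to the base `m` (relative indices, from `0`). [folklore] -/
def relGap (hB : ∀ n, ∃ m, n ≤ m ∧ B m) (m : ℕ) : ℕ → ℕ :=
  bGap (shift_io hB m) 0

/-- [OURS] The length of the segment based at `m`, read in the chain shifted to `m`. [cite: CossartJannsenSaito2020, Def. 6.38] -/
def relLen (hB : ∀ n, ∃ m, n ≤ m ∧ B m) (hBG : ∀ n, ∃ m, n ≤ m ∧ B m ∧ G m) (m : ℕ) : ℕ :=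
  segLen (shift_io hB m) (shift_io₂ hBG m) 0

/-- [OURS] The relative index (from the base `m`) of the `k`-th `B`-stage of the segment: `cidx 0 (relGap m) k`. [folklore] -/
abbrev relIdx (hB : ∀ n, ∃ m, n ≤ m ∧ B m) (m k : ℕ) : ℕ :=
  BlowupTower.cidx 0 (relGap hB m) k

/-- [OURS] The base of the NEXT segment: `m + relIdx m (relLen m)` (the terminal stage of the segment based at `m`).
[cite: CossartJannsenSaito2020, Def. 6.39] -/
def nextBase (hB : ∀ n, ∃ m, n ≤ m ∧ B m) (hBG : ∀ n, ∃ m, n ≤ m ∧ B m ∧ G m) (m : ℕ) : ℕ :=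
  m + relIdx hB m (relLen hB hBG m)

/-- `1 ≤ relLen`. [folklore] -/
theorem one_le_relLen (hB : ∀ n, ∃ m, n ≤ m ∧ B m) (hBG : ∀ n, ∃ m, n ≤ m ∧ B m ∧ G m) (m : ℕ) : 1 ≤ relLen hB hBG m :=
  one_le_segLen _ _ 0

/-- Every `B`-stage of the segment is blown up: `B (m + relIdx m k)` (for a `B`-stage base `m`). [folklore] -/
theorem B_add_relIdx (hB : ∀ n, ∃ m, n ≤ m ∧ B m) {m : ℕ} (hm : B m) (k : ℕ) : B (m + relIdx hB m k) :=
  B_cidx_bGap (shift_io hB m) (n₀ := 0) (by simpa using hm) k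

/-- The skipped stages of the segment are not blown up: `¬ B (m + (relIdx m k + j + 1))` for `j < relGap m k`. [folklore] -/
theorem not_B_add_relIdx_add (hB : ∀ n, ∃ m, n ≤ m ∧ B m) (m : ℕ) {k j : ℕ} (hj : j < relGap hB m k) :
    ¬ B (m + (relIdx hB m k + j + 1)) :=
  not_B_cidx_bGap_add (shift_io hB m) 0 hj

/-- Every `B`-stage `m + k` after the base is some `B`-stage of the segment enumeration. [folklore] -/
theorem exists_relIdx_eq (hB : ∀ n, ∃ m, n ≤ m ∧ B m) (m : ℕ) {k : ℕ} (hk : B (m + k)) : ∃ l, relIdx hB m l = k :=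
  exists_cidx_bGap_eq (shift_io hB m) (Nat.zero_le k) hk

/-- The terminal stage of the segment is a cut stage: `G (nextBase m)`. [folklore] -/
theorem G_nextBase (hB : ∀ n, ∃ m, n ≤ m ∧ B m) (hBG : ∀ n, ∃ m, n ≤ m ∧ B m ∧ G m) (m : ℕ) : G (nextBase hB hBG m) :=
  G_cidx_segLen (shift_io hB m) (shift_io₂ hBG m) 0

/-- The terminal stage of the segment is blown up (for a `B`-stage base). [folklore] -/
theorem B_nextBase (hB : ∀ n, ∃ m, n ≤ m ∧ B m) (hBG : ∀ n, ∃ m, n ≤ m ∧ B m ∧ G m) {m : ℕ} (hm : B m) : B (nextBase hB hBG m) :=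
  B_add_relIdx hB hm _

/-- Minimality: no `B`-stage of the segment strictly before the terminal one (and after the base) is a cut stage. [folklore] -/
theorem not_G_add_relIdx_of_lt_relLen (hB : ∀ n, ∃ m, n ≤ m ∧ B m) (hBG : ∀ n, ∃ m, n ≤ m ∧ B m ∧ G m) (m : ℕ) {L : ℕ} (h1 : 1 ≤ L)
    (hL : L < relLen hB hBG m) : ¬ G (m + relIdx hB m L) :=
  not_G_cidx_of_lt_segLen (shift_io hB m) (shift_io₂ hBG m) 0 h1 hL

/-- The base precedes the terminal stage strictly: `m < nextBase m`. [folklore] -/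
theorem lt_nextBase (hB : ∀ n, ∃ m, n ≤ m ∧ B m) (hBG : ∀ n, ∃ m, n ≤ m ∧ B m ∧ G m) (m : ℕ) : m < nextBase hB hBG m := by
  have := lt_cidx_bGap_of_pos (shift_io hB m) 0 (one_le_relLen hB hBG m)
  unfold nextBase relIdx relGap
  omega

open Classical in
/-- [OURS] THE BASES `m_0 < m_1 < ⋯` OF THE CONSECUTIVE SEGMENTS: `m_0` the least stage with `B ∧ G`, `m_{i+1} = nextBase m_i`.
[cite: CossartJannsenSaito2020, Def. 6.39] -/
def segBase (hB : ∀ n, ∃ m, n ≤ m ∧ B m) (hBG : ∀ n, ∃ m, n ≤ m ∧ B m ∧ G m) : ℕ → ℕ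
  | 0 => Nat.find (hBG 0)
  | i + 1 => nextBase hB hBG (segBase hB hBG i)

/-- Unfolding: `m_{i+1} = nextBase m_i`. [folklore] -/
theorem segBase_succ (hB : ∀ n, ∃ m, n ≤ m ∧ B m) (hBG : ∀ n, ∃ m, n ≤ m ∧ B m ∧ G m) (i : ℕ) :
    segBase hB hBG (i + 1) = nextBase hB hBG (segBase hB hBG i) := rfl

open Classical in
/-- Every base is blown up and is a cut stage. [folklore] -/
theorem B_and_G_segBase (hB : ∀ n, ∃ m, n ≤ m ∧ B m) (hBG : ∀ n, ∃ m, n ≤ m ∧ B m ∧ G m) :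
    ∀ i, B (segBase hB hBG i) ∧ G (segBase hB hBG i)
  | 0 => (Nat.find_spec (hBG 0)).2
  | i + 1 => ⟨B_nextBase hB hBG (B_and_G_segBase hB hBG i).1, G_nextBase hB hBG _⟩

/-- Every base is blown up. [folklore] -/
theorem B_segBase (hB : ∀ n, ∃ m, n ≤ m ∧ B m) (hBG : ∀ n, ∃ m, n ≤ m ∧ B m ∧ G m) (i : ℕ) : B (segBase hB hBG i) :=
  (B_and_G_segBase hB hBG i).1

/-- Every base is a cut stage. [folklore] -/
theorem G_segBase (hB : ∀ n, ∃ m, n ≤ m ∧ B m) (hBG : ∀ n, ∃ m, n ≤ m ∧ B m ∧ G m) (i : ℕ) : G (segBase hB hBG i) :=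
  (B_and_G_segBase hB hBG i).2

/-- The bases increase strictly. [folklore] -/
theorem segBase_strictMono (hB : ∀ n, ∃ m, n ≤ m ∧ B m) (hBG : ∀ n, ∃ m, n ≤ m ∧ B m ∧ G m) : StrictMono (segBase hB hBG) :=
  strictMono_nat_of_lt_succ fun i => lt_nextBase hB hBG (segBase hB hBG i)

end Summit.ResolutionOfSingularities.ResolutionOfSingularities.Theorems.SigmaMaxModificationsCorridor3.Moving.Seg

end
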